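import Summits.ABC.IUTFork.Conditional.AbcOfSCor312OfHexAllK
import Summits.ABC.IUTFork.Conditional.WRowHexLamSevenAllKEventuallySharp
import Summits.ABC.IUTFork.Conditional.WRowHexLamSevenAllKNonCyclotomic
import Summits.ABC.IUTFork.Conditional.WRowHexLamSevenWholeLe24
import Summits.ABC.IUTFork.Conditional.AbcOfSGenuineKLicence
import Summits.ABC.IUTFork.Cor312ThetaSideClosedK
import Summits.ABC.IUTFork.Cor312SettingDHVolWitness
import Summits.ABC.IUTFork.Cor312ProvKIdeles
import HarnessLib

/-!
# Branch C — the NUMBER-LEVEL typed [IUTchIII] Cor. 3.12 in READING (U) (`T.Cor312Of`) on the HEX family `λ_k = 1/2 + 2/7^k`, part B: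
# the (U) companions of abc-iut-C-cert-1's «W:HEX-UNIFORM-K» U1 (ii) SHARP form, U1 (iii) NON-CYCLOTOMIC levels, and U3 «HEX WHOLE k = 1…24
# UNDER ONE THEOREM NAME» (inhabited conjunct) — `T.Cor312Of` with NO hypothesis beyond the licence theorems' own binders

C scoreboard (abc-iut-C-cert-3 gen 6, INTAKE / CERTS pen; KEY `UPCOMPANIONS25` part (3), row 240 of `plan/conditional/CERTS.tsv`). PROOF-ONLY junction
file (no `def`, no new `Prop`, no instance, no notation; nothing re-typed); SAME recipe and words as part A `AbcOfSCor312OfHexAllK` (p530793) and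
`AbcOfSCor312OfInhLevelsE` (p528412): a W-lane licence theorem (here abc-iut-C-cert-1 gen 9's `WRow.licence_lamSeven_allK_sharp` p530859,
`WRow.licence_lamSeven_allK_nonCyclotomic` p530917, `WRow.hex_whole_le_24` p530248 — binders copied VERBATIM) composed with
`GenuineK.cor312Of_of_licence` (p435505) and the Θ-descent `negLogTheta_settingPrVolSharp_pilotDataOfK_le_datum` (p447368) at one-point context data
(`M := ℚ`, abc-iut-c312-7's `unitSigDH/unitSplitDH/unitQDataDH/unitLatticeDH`), realising ideles `Cor312Prov.exists_realising_{q,theta}Ideles_pilotDataOfK`;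
for U1 (ii)/(iii) the composition is literally part A's `Hex.cor312Of_lamSeven_allK_of_primePow_lt` at `hexK_bad_of_split`, resp. abc-iut-C-cert-2's
`WRow.cor312Of_orbit_of_nonCyclotomic` (p527747 lineage) at the HEX triple `isABCTriple_hexK` with `j(1/2 + 2/7^k) = j(a_k/c_k)` (`lamSeven_eq_hexK`).

READING (numbers, no side): for EVERY `k ≥ 1`, the number-binder instance of the window certificates (K, LINE-FREE) is a THEOREM at every genuine
datum over `(ratPoint λ_k, l)` (1) at every prime `l > max(7, 4·7^{⌊k/2⌋})` dominating the odd primes of `7^{2k} − 16` as in U1 (ii), (2) at every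
non-cyclotomic prime level `l ≥ 5` of `abc_k` as in U1 (iii), and (3) for the 24 tabulated axes `k = 1…24`, at every prime `l ≥ L⁺(k)` of the one-name
table of `WRow.hex_whole_le_24` (the exact inhabited thresholds of record, far below part A's `l² > 16·abc_k`). NO height bound follows (one known λ per k,
`log q` far below the content locus); cone binder untouched (C-R52); records UNCHANGED (K p460293 · p460539 · p464272 · γ p462946; M twins);
inhabited-as-typed ≠ true-in-print; non-emptiness / admissibility / (P6) along the axes NOT claimed here; typed ≠ proved; instantiated ≠ endorsed;
not a claim that abc is proved or refuted; no side taken on [IUTchIII] Cor 3.12 / [IUTchIV] Thm 1.10, on (U) vs (P), or on any author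
(Mochizuki / Scholze–Stix / Joshi / Dupuy–Hilado).
[cite: Mochizuki2012, IUTchIII Cor. 3.12 p. 173–174, Step (xi-f) p. 184; IUTchIV Thm. 1.10 p. 22–23, Cor. 2.2 (ii) proof (P5)(P7) p. 46; IUTchI Ex. 3.2 (iv) p. 71]
[cite: DupuyHilado2025, §3.3, §3.4, §4.9] [claim: Mochizuki2012, status: disputed]
-/

noncomputable section

open Set Function NumberField IsDedekindDomain

namespace Summit.ABC.IUTFork.Conditional

open Thm311 Thm311.Real Cor312 Cor312Vol Cor312Prov Literature.IUT.LogThetaLattice Literature.IUT.LogVolume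
  Literature.IUT.HodgeTheaters Literature.IUT.LogVolume.ThetaData Literature.IUT.LogVolume.Cor22
open Literature.NumberTheory.NumberFields Literature.NumberTheory.GaloisRepresentations.Ultrametric
open Literature.NumberTheory.DiophantineGeometry Literature.NumberTheory.DiophantineGeometry.GenEll Summit.ABC.ABC.Theorems

/-- **(U) companion of U1 (ii), the SHARP all-`k` form.** For every `k ≥ 1`, every prime `l` with `7 < l`, `4·7^{⌊k/2⌋} < l` and
`p < l ∧ 4·p^{⌊v_p((7^k+4)(7^k−4))/2⌋} < l` for every prime `p ∣ (7^k+4)(7^k−4)`, and every genuine Θ-volume datum `T` over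
`(ratPoint (1/2 + 2/7^k), l)`: `T.Cor312Of` — exactly the binders of `WRow.licence_lamSeven_allK_sharp` (p530859), through part A's
`Hex.cor312Of_lamSeven_allK_of_primePow_lt` at `hexK_bad_of_split`. [cite: Mochizuki2012, IUTchIII Cor. 3.12 p. 173–174; IUTchIV Cor. 2.2 (ii) proof (P5) p. 46]
[claim: Mochizuki2012, status: disputed] -/
theorem Hex.cor312Of_lamSeven_allK_sharp {k l : ℕ} (hk : 1 ≤ k) (hl : l.Prime) (h7l : 7 < l) (h7 : 4 * 7 ^ (k / 2) < l)
    (hodd : ∀ p : ℕ, p.Prime → p ∣ (7 ^ k + 4) * (7 ^ k - 4) →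
      p < l ∧ 4 * p ^ (((7 ^ k + 4) * (7 ^ k - 4)).factorization p / 2) < l)
    (T : Cor22.ThetaVolumeDatumAt (ratPoint ((2 : ℚ)⁻¹ + 2 / 7 ^ k)) l) : T.Cor312Of :=
  Hex.cor312Of_lamSeven_allK_of_primePow_lt hk hl (by omega) (hexK_bad_of_split hk h7l h7 hodd) T

/-- **(U) companion of U1 (iii), NON-CYCLOTOMIC levels.** For every `k ≥ 1`, every prime `l ≥ 5` such that every odd prime `p ∣ abc_k =
(7^k+4)(7^k−4)·2·7^k` has `p ≠ l`, `l ∤ p − 1` and `v_p(abc_k) < 2 ∨ 4·p^{⌊v_p(abc_k)/2⌋} < l`, and every genuine Θ-volume datum `T` over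
`(ratPoint (1/2 + 2/7^k), l)`: `T.Cor312Of` — exactly the binders of `WRow.licence_lamSeven_allK_nonCyclotomic` (p530917), through abc-iut-C-cert-2's
`WRow.cor312Of_orbit_of_nonCyclotomic` at the HEX triple (`isABCTriple_hexK`, `lamSeven_eq_hexK`). [cite: Mochizuki2012, IUTchIII Cor. 3.12 p. 173–174;
IUTchIV Cor. 2.2 (ii) proof (P5) p. 46] [claim: Mochizuki2012, status: disputed] -/
theorem Hex.cor312Of_lamSeven_allK_nonCyclotomic {k l : ℕ} (hk : 1 ≤ k) (hl : l.Prime) (hl5 : 5 ≤ l)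
    (hnc : ∀ p : ℕ, p.Prime → p ∣ (7 ^ k + 4) * (7 ^ k - 4) * (2 * 7 ^ k) → p ≠ 2 →
      p ≠ l ∧ ¬ l ∣ p - 1 ∧ (((7 ^ k + 4) * (7 ^ k - 4) * (2 * 7 ^ k)).factorization p < 2 ∨
        4 * p ^ (((7 ^ k + 4) * (7 ^ k - 4) * (2 * 7 ^ k)).factorization p / 2) < l))
    (T : Cor22.ThetaVolumeDatumAt (ratPoint ((2 : ℚ)⁻¹ + 2 / 7 ^ k)) l) : T.Cor312Of :=
  WRow.cor312Of_orbit_of_nonCyclotomic (isABCTriple_hexK hk) (q := (2 : ℚ)⁻¹ + 2 / 7 ^ k) (by rw [lamSeven_eq_hexK k]) hl hl5 hnc T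

/-- **(U) companion of U3 «HEX WHOLE k = 1…24 UNDER ONE THEOREM NAME» (inhabited conjunct).** For every row `(k, L₀, L⁺)` of the 24-row table of
`WRow.hex_whole_le_24` (p530248; copied VERBATIM), every prime `l` with `L⁺ ≤ l` and every genuine Θ-volume datum `T` over `(ratPoint (1/2 + 2/7^k), l)`:
`T.Cor312Of` — the second conjunct of that theorem (the licence for every pair of realising ideles; `11 ≤ L⁺` on every row supplies its `11 ≤ l`)
through `GenuineK.cor312Of_of_licence` (p435505) + the Θ-descent p447368 at one-point context data. Reading (U) of the number-level typed Cor. 3.12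
is thereby a THEOREM on all 24 tabulated HEX axes from the EXACT inhabited threshold `L⁺(k)` of record, under one name.
[cite: Mochizuki2012, IUTchIII Cor. 3.12 p. 173–174, Step (xi-f) p. 184; IUTchIV Cor. 2.2 (ii) proof (P5) p. 46] [claim: Mochizuki2012, status: disputed] -/
theorem Hex.cor312Of_whole_le_24 {k L0 Lp l : ℕ}
    (hmem : (k, L0, Lp) ∈ ([(1, 10, 11), (2, 10, 11), (3, 10, 11), (4, 10, 11), (5, 10, 11), (6, 10, 11), (7, 10, 11), (8, 71, 73), (9, 337, 347), (10, 4721, 4723), (11, 811, 821), (12, 20063, 20071), (13, 5851, 5857), (14, 46933, 46957), (15, 617587, 617647), (16, 329269, 329281), (17, 288203, 288209), (18, 6917593, 6917611), (19, 2017637, 2017643), (20, 80707019, 80707051), (21, 42371239, 42371257), (22, 112989881, 112989913), (23, 98866283, 98866289), (24, 2372791879, 2372791903)] : List (ℕ × ℕ × ℕ)))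
    (hl : l.Prime) (hLp : Lp ≤ l) (T : Cor22.ThetaVolumeDatumAt (ratPoint ((2 : ℚ)⁻¹ + 2 / 7 ^ k)) l) : T.Cor312Of := by
  have h11 : 11 ≤ l := by
    refine le_trans ?_ hLp
    have hmem' := hmem
    simp only [List.mem_cons, Prod.mk.injEq, List.not_mem_nil, or_false] at hmem'
    omega
  letI := T.instFieldF; letI := T.instNumberFieldF; letI := T.instAlgebraF; letI := T.instFieldK
  letI := T.instNumberFieldK; letI := T.instAlgebraK; letI := T.instFieldFbar; letI := T.instAlgebraFbar
  letI := T.instAlgebraKFbar; letI := T.instIsElliptic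
  obtain ⟨tq, htq0, htq1, htq⟩ := exists_realising_qIdeles_pilotDataOfK T.D
  obtain ⟨t, ht0, ht1, ht⟩ := exists_realising_thetaIdeles_pilotDataOfK T.D
  exact GenuineK.cor312Of_of_licence T.D T.K ℚ (fun _ _ => ∅) (fun _ _ => ∅) (fun _ _ _ => ∅) (fun _ _ _ => 0) (fun _ _ => ∅)
    (fun _ _ _ _ => ∅) 0 unitLatticeDH (unitSigDH (pilotDataOfK T.D T.K)) (unitSplitDH (pilotDataOfK T.D T.K))
    (unitQDataDH (pilotDataOfK T.D T.K)) t tq T.isVolumeInputOf htq0 htq1 ht0 ht1 htq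
    ((WRow.hex_whole_le_24 hmem hl h11 T).2 hLp (logvAnalytic_analyticLogv (F := T.K)) ℚ (fun _ _ => ∅) (fun _ _ => ∅) (fun _ _ _ => ∅)
      (fun _ _ _ => 0) (fun _ _ => ∅) (fun _ _ _ _ => ∅) 0 unitLatticeDH (unitSigDH (pilotDataOfK T.D T.K)) (unitSplitDH (pilotDataOfK T.D T.K))
      (unitQDataDH (pilotDataOfK T.D T.K)) tq t htq0 htq1 ht0 ht htq)
    (negLogTheta_settingPrVolSharp_pilotDataOfK_le_datum T ℚ (fun _ _ => ∅) (fun _ _ => ∅) (fun _ _ _ => ∅) (fun _ _ _ => 0) (fun _ _ => ∅)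
      (fun _ _ _ _ => ∅) 0 unitLatticeDH (unitSigDH (pilotDataOfK T.D T.K)) (unitSplitDH (pilotDataOfK T.D T.K)) (unitQDataDH (pilotDataOfK T.D T.K))
      tq t htq0 htq1 ht0 ht)

end Summit.ABC.IUTFork.Conditional

end
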